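import Literature.AlgebraicGeometry.Frobenioids.ArchimedeanRationallyStandard
import Literature.AlgebraicGeometry.Frobenioids.Thm36SubPerfectionUntrEquiv
import HarnessLib

/-!
# Frobenioids II, Thm. 3.6 (i), proof p. 38: "every object of `((C^Λ)^un-tr)^birat = (C^ℝ)^birat` is
# Frobenius-compact" — PROVED in the EVERY-OBJECT form, `Λ ∈ {ℤ, ℚ, ℝ}`

Mochizuki, *The geometry of Frobenioids II: poly-Frobenioids*, Kyushu J. Math. **62** (2008) 401–460, §3,
Thm. 3.6 (i), proof, kurims text p. 38 ll. 26–30 (journal p. 432): "Also, it is immediate from the construction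
of `C^ℝ` that every object of `((C^Λ)^un-tr)^birat = (C^ℝ)^birat` is Frobenius-compact."
[cite: MochizukiFrdII2008, Thm 3.6 (i) p.36]  (Frobenius-compact: [FrdI] Def. 1.2 (iv) / Def. 4.5 (iii)(b),
"`O^×(A^birat)` admits an element whose conjugates by automorphisms of `A^birat` are non-torsion …", in the
cell's form `PreFrobenioidData.IsFrobeniusCompact`.)

PROOF-ONLY file (abc-iut cell, layer L1, row «M13-c6»; seat abc-iut-w5-d237, gen 4).  The tree had this
printed sentence only in the EXISTENCE form that [FrdI] Def. 4.5 (iii)(b) consumes, at `Λ = ℤ`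
(abc-iut-L1-t9's `ArchFrd.C.exists_isFrobeniusCompact_untrBirat`, `ArchimedeanRationallyStandard.lean`).  Here
the sentence is closed as printed — for EVERY object — at all three `Λ`, at THE unit-trivialisation `C^un-tr`
(`PreFrobenioid.untrFunctor`, abc-iut-L1-d5/found) and THE birationalization (`PreFrobenioid.Birat`, a type
synonym whose objects ARE the objects of `(C^Λ)^un-tr`, abc-iut-L6-t8), by abc-iut-L6-t10's criterion
`PreFrobenioid.Birat.untr_isFrobeniusCompact_of_invariant` (a non-torsion element of `Φ^birat(A_D)` invariant
under the base maps of the automorphisms of `A^birat` suffices) at the divisor `1 ∈ ℝ_{≥0}` read in the three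
divisor monoids:
* `C.untrBirat_isFrobeniusCompact` — `Λ = ℤ` (`Φ = ℝ_{≥0}`): `Φ^birat = Φ^gp` (abc-iut-w4-d074's
  `Thm36Sub.biratSubfunctor_carrier_eq_top`), `Φ` cancellative, transition maps identities (`Φ_map_eq_id`) —
  L1-t9's existence proof with the object made a parameter;
* `Thm36Sub.pf_untrBirat_isFrobeniusCompact` — `Λ = ℚ` (`C^ℚ := C^pf`, divisor monoid `Φ^pf`):
  `(Φ^pf)^birat = (Φ^pf)^gp` (w5-d237's `biratSubfunctor_pfStr_carrier_eq_top`, p428517), `Φ^pf` divisorial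
  hence cancellative (the Frobenioid `C^pf`, `C.pf_isFrobenioid`), `Φ → Φ^pf` injective
  (`ℝ_{≥0}` perfect), transition maps `(id)^pf = id`;
* `Thm36Sub.rlf_untrBirat_isFrobeniusCompact` — `Λ = ℝ` (`C^ℝ := C^rlf`, divisor monoid `Φ^rlf`), over a
  connected, totally epimorphic base (Ex. 3.3 (i)'s standing hypotheses, for the Frobenioid structure of `C^rlf`,
  w4-d074's `Thm36Sub.rlf_isFrobenioid`): `(Φ^rlf)^birat = (Φ^rlf)^gp` (`biratSubfunctor_rlfStr_carrier_eq_top`),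
  `Φ → Φ^rlf` bijective (`bijective_toRlf_app`), transition maps identities (`rlfFunctor_Φ_map_apply`).
No definitions; no statement of the paper is strengthened or re-typed; nothing here bears on [IUTchIII] Cor. 3.12
(classical, refereed [FrdI]/[FrdII]); typed ≠ proved except where a `theorem` says so.
-/

noncomputable section

namespace Literature.AlgebraicGeometry.Frobenioids

open CategoryTheory Opposite Function Literature.AnabelianGeometry.EtaleTheta
open scoped NNReal

universe v u

namespace ArchFrd

variable {D : Type u} [Category.{v} D] (π : D ⥤ D0)

/-- The divisor `N · 1 ∈ ℝ_{≥0}` (`N ≥ 1`) is not `0`: `(ofAdd 1)^N ≠ 1` in `Φ(X) = ℝ_{≥0}` written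
multiplicatively. [cite: MochizukiFrdII2008, Ex 3.3 (i) p.28] -/
theorem ofAdd_one_pow_ne_one {N : ℕ} (hN : 0 < N) :
    (Multiplicative.ofAdd (1 : ℝ≥0)) ^ N ≠ (1 : Multiplicative ℝ≥0) := by
  intro h
  have h' : N • (1 : ℝ≥0) = 0 := by
    have := congrArg Multiplicative.toAdd h
    rwa [toAdd_pow, toAdd_one, toAdd_ofAdd] at this
  rw [nsmul_eq_mul, mul_one, Nat.cast_eq_zero] at h'
  omega

/-! ### `Λ = ℤ`: every object of `(C^un-tr)^birat` is Frobenius-compact -/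

/-- **"Every object of `(C^un-tr)^birat` is Frobenius-compact"**, `Λ = ℤ` (`C^ℤ = C`), EVERY-OBJECT form of
abc-iut-L1-t9's `C.exists_isFrobeniusCompact_untrBirat`: for every object `A` of `C^un-tr` over `X`, the divisor
`d₀ = 1 ∈ ℝ_{≥0} = Φ(X)` lies in `Φ^birat(X) = Φ(X)^gp`, is non-torsion, and is invariant under every base map
(the transition maps of `Φ = Φ₀|_D` are identities). [cite: MochizukiFrdII2008, Thm 3.6 (i) p.36] -/
theorem C.untrBirat_isFrobeniusCompact (hF : PreFrobenioid.IsFrobenioid (C.toElem π))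
    (Y : PreFrobenioid.Birat (PreFrobenioid.untrFunctor hF) (PreFrobenioid.isFrobenioid_untr hF)
      (PreFrobenioid.hasBiratSquares_untr hF)) :
    (PreFrobenioid.biratOps (PreFrobenioid.isFrobenioid_untr hF)
      (PreFrobenioid.hasBiratSquares_untr hF)).IsFrobeniusCompact Y := by
  let a : (Φ π).obj (op (PreFrobenioid.baseObj (PreFrobenioid.untrFunctor hF) Y.out)) :=
    Multiplicative.ofAdd (1 : ℝ≥0)
  refine PreFrobenioid.Birat.untr_isFrobeniusCompact_of_invariant hF Y.out (Algebra.GrothendieckGroup.of a)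
    ?_ ?_ ?_
  · -- `Φ^birat(X) = Φ(X)^gp`
    change _ ∈ (PreFrobenioid.biratSubfunctor (C.toElem π)).carrier _
    rw [Thm36Sub.biratSubfunctor_carrier_eq_top]
    exact Subgroup.mem_top _
  · -- non-torsion
    intro N hN h
    haveI : IsCancelMul ((Φ π).obj (op (PreFrobenioid.baseObj (PreFrobenioid.untrFunctor hF) Y.out))) :=
      isIntegral_iff_isCancelMul.mp isIntegral_nnreal
    have hinj : Injective (Algebra.GrothendieckGroup.of
        (M := (Φ π).obj (op (PreFrobenioid.baseObj (PreFrobenioid.untrFunctor hF) Y.out)))) :=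
      Algebra.GrothendieckGroup.of_injective
    have h' : a ^ N = 1 := hinj (by rw [map_pow, map_one]; exact h)
    change (Multiplicative.ofAdd (1 : ℝ≥0)) ^ N = (1 : Multiplicative ℝ≥0) at h'
    exact ofAdd_one_pow_ne_one hN h'
  · -- invariance: the transition maps of `Φ` are identities
    intro f
    rw [pullGp_of, Thm36Sub.Φ_map_eq_id]
    rfl

namespace Thm36Sub

/-! ### `Λ = ℚ`: every object of `((C^pf)^un-tr)^birat` is Frobenius-compact -/

/-- The transition maps of the divisor monoid `Φ^pf` of THE perfection are identities (`Φ(f) = id`, so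
`Φ(f)^pf = id`). [cite: MochizukiFrdII2008, Ex 3.3 (ii) p.28] -/
theorem ops_monFunctor_map_apply (hF : PreFrobenioid.IsFrobenioid (C.toElem π)) {j j' : Dᵒᵖ} (f : j ⟶ j')
    (x : (PreFrobenioid.Perfection.ops hF).monFunctor.obj j) :
    ((PreFrobenioid.Perfection.ops hF).monFunctor.map f).hom x = x := by
  change Frobenioids.Perfection.map (((Φ π).map f.unop.op).hom) x = x
  rw [Φ_map_eq_id]
  exact DFunLike.congr_fun Frobenioids.Perfection.map_id x

/-- **"Every object of `((C^ℚ)^un-tr)^birat` is Frobenius-compact"**, `C^ℚ := C^pf`: for every object `A` of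
`(C^pf)^un-tr` over `X`, the divisor `d₀ = [1] ∈ Φ^pf(X)` lies in `(Φ^pf)^birat(X) = (Φ^pf)^gp(X)`
(`biratSubfunctor_pfStr_carrier_eq_top`), is non-torsion (`Φ^pf(X)` is divisorial, hence cancellative, for the
Frobenioid `C^pf`; `Φ(X) → Φ^pf(X)` is injective since `ℝ_{≥0}` is perfect), and is invariant under every base
map (the transition maps of `Φ^pf` are identities). [cite: MochizukiFrdII2008, Thm 3.6 (i) p.36] -/
theorem pf_untrBirat_isFrobeniusCompact (hF : PreFrobenioid.IsFrobenioid (C.toElem π))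
    (Y : PreFrobenioid.Birat (PreFrobenioid.untrFunctor (C.pf_isFrobenioid π hF))
      (PreFrobenioid.isFrobenioid_untr (C.pf_isFrobenioid π hF))
      (PreFrobenioid.hasBiratSquares_untr (C.pf_isFrobenioid π hF))) :
    (PreFrobenioid.biratOps (PreFrobenioid.isFrobenioid_untr (C.pf_isFrobenioid π hF))
      (PreFrobenioid.hasBiratSquares_untr (C.pf_isFrobenioid π hF))).IsFrobeniusCompact Y := by
  let hPf := C.pf_isFrobenioid π hF
  let X : D := PreFrobenioid.baseObj (PreFrobenioid.untrFunctor hPf) Y.out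
  let a₀ : (Φ π).obj (op X) := Multiplicative.ofAdd (1 : ℝ≥0)
  let a : (PreFrobenioid.Perfection.ops hF).monFunctor.obj (op X) := Frobenioids.Perfection.of _ a₀
  refine PreFrobenioid.Birat.untr_isFrobeniusCompact_of_invariant hPf Y.out (Algebra.GrothendieckGroup.of a)
    ?_ ?_ ?_
  · -- `(Φ^pf)^birat(X) = (Φ^pf)^gp(X)`
    change _ ∈ (PreFrobenioid.biratSubfunctor (pfStr π hF)).carrier _
    rw [biratSubfunctor_pfStr_carrier_eq_top]
    exact Subgroup.mem_top _
  · -- non-torsion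
    intro N hN h
    haveI : IsCancelMul ((PreFrobenioid.Perfection.ops hF).monFunctor.obj (op X)) :=
      isIntegral_iff_isCancelMul.mp (hPf.isPreFrobenioid.isDivisorial X).isPreDivisorial.isIntegral
    have hinj : Injective (Algebra.GrothendieckGroup.of
        (M := (PreFrobenioid.Perfection.ops hF).monFunctor.obj (op X))) :=
      Algebra.GrothendieckGroup.of_injective
    have h' : a ^ N = 1 := hinj (by rw [map_pow, map_one]; exact h)
    have h'' : Frobenioids.Perfection.of _ (a₀ ^ N) = Frobenioids.Perfection.of _ 1 := by
      rw [map_pow, map_one]; exact h'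
    have h₃ : a₀ ^ N = 1 := (isPerfect_iff_bijective_of.mp isPerfect_multiplicative_nnreal).1 h''
    change (Multiplicative.ofAdd (1 : ℝ≥0)) ^ N = (1 : Multiplicative ℝ≥0) at h₃
    exact ofAdd_one_pow_ne_one hN h₃
  · -- invariance: the transition maps of `Φ^pf` are identities
    intro f
    rw [pullGp_of, ops_monFunctor_map_apply]

/-! ### `Λ = ℝ`: every object of `((C^rlf)^un-tr)^birat` is Frobenius-compact -/

/-- **"Every object of `((C^ℝ)^un-tr)^birat = (C^ℝ)^birat` is Frobenius-compact"**, `C^ℝ := C^rlf`, over a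
connected, totally epimorphic base (Ex. 3.3 (i); used for the Frobenioid structure of `C^rlf`): for every object
`A` of `(C^rlf)^un-tr` over `X`, the divisor `d₀ = ι(1) ∈ Φ^rlf(X)` lies in `(Φ^rlf)^birat(X) = (Φ^rlf)^gp(X)`
(`biratSubfunctor_rlfStr_carrier_eq_top`), is non-torsion (`Φ^rlf(X)` cancellative; `ι : Φ(X) → Φ^rlf(X)`
injective, `bijective_toRlf_app`), and is invariant under every base map (`rlfFunctor_Φ_map_apply`).
[cite: MochizukiFrdII2008, Thm 3.6 (i) p.36] -/
theorem rlf_untrBirat_isFrobeniusCompact (hDc : IsGraphConnected D) (hDe : IsTotallyEpimorphic D)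
    (Y : PreFrobenioid.Birat (PreFrobenioid.untrFunctor (rlf_isFrobenioid π hDc hDe))
      (PreFrobenioid.isFrobenioid_untr (rlf_isFrobenioid π hDc hDe))
      (PreFrobenioid.hasBiratSquares_untr (rlf_isFrobenioid π hDc hDe))) :
    (PreFrobenioid.biratOps (PreFrobenioid.isFrobenioid_untr (rlf_isFrobenioid π hDc hDe))
      (PreFrobenioid.hasBiratSquares_untr (rlf_isFrobenioid π hDc hDe))).IsFrobeniusCompact Y := by
  let hR := rlf_isFrobenioid π hDc hDe
  let X : D := PreFrobenioid.baseObj (PreFrobenioid.untrFunctor hR) Y.out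
  let ι := (RealificationData.canonical (Φ π)
    (PreFrobenioid.IsPerfFactorialOn.op (isPerfFactorialOn_Φ π))).toRlf.app (op X)
  let a₀ : (Φ π).obj (op X) := Multiplicative.ofAdd (1 : ℝ≥0)
  let a : (rlfFunctor (Φ π) (PreFrobenioid.IsPerfFactorialOn.op (isPerfFactorialOn_Φ π))).obj (op X) :=
    ι.hom a₀
  refine PreFrobenioid.Birat.untr_isFrobeniusCompact_of_invariant hR Y.out (Algebra.GrothendieckGroup.of a)
    ?_ ?_ ?_
  · -- `(Φ^rlf)^birat(X) = (Φ^rlf)^gp(X)`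
    change _ ∈ (PreFrobenioid.biratSubfunctor (rlfStr π)).carrier _
    rw [biratSubfunctor_rlfStr_carrier_eq_top]
    exact Subgroup.mem_top _
  · -- non-torsion
    intro N hN h
    haveI : IsCancelMul
        ((rlfFunctor (Φ π) (PreFrobenioid.IsPerfFactorialOn.op (isPerfFactorialOn_Φ π))).obj (op X)) :=
      isIntegral_iff_isCancelMul.mp (hR.isPreFrobenioid.isDivisorial X).isPreDivisorial.isIntegral
    have hinj : Injective (Algebra.GrothendieckGroup.of
        (M := (rlfFunctor (Φ π) (PreFrobenioid.IsPerfFactorialOn.op (isPerfFactorialOn_Φ π))).obj (op X))) :=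
      Algebra.GrothendieckGroup.of_injective
    have h' : a ^ N = 1 := hinj (by rw [map_pow, map_one]; exact h)
    have h'' : ι.hom (a₀ ^ N) = ι.hom 1 := by
      rw [map_pow, map_one]; exact h'
    have h₃ : a₀ ^ N = 1 := (bijective_toRlf_app π (op X)).1 h''
    change (Multiplicative.ofAdd (1 : ℝ≥0)) ^ N = (1 : Multiplicative ℝ≥0) at h₃
    exact ofAdd_one_pow_ne_one hN h₃
  · -- invariance: the transition maps of `Φ^rlf` are identities
    intro f
    rw [pullGp_of, rlfFunctor_Φ_map_apply]

end Thm36Sub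

end ArchFrd

end Literature.AlgebraicGeometry.Frobenioids

end
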